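import Summits.CriticalPhenomena.PercolationContinuityZ3.Theorems.PercNearOneGluingNoHeavyLowerTailKnQuestion8CoefficientwiseCoreClassKernelMixShortThreadEdge
import HarnessLib

/-!
# THEOREM A (thread slicing, ℓ = 2) as an exact identity: IET(G ∥ P₂) = IET(G)[w-shift] + IET(G)[partial w-shift] + IET(G ∥ K₂)[w-shift]

Support file (`--supports stmt-CriticalPhenomena-4575`, closed), prover `prim-cplus-coupling` (gen 53).  No definitions, no notations, no named facts,
no sorries; standard axioms.  Memo `prim-cplus-coupling/A5-COUPLING-gen53.md` §1.1–1.3 (THEOREM A, (A1) and (A3)).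

For an ARBITRARY finite multigraph (`ends : ι → Sym2 V`, edge set `E′`), root `u`, observer `b`, and a path `u – x – b` of length 2 through a fresh
vertex `x` with edge indices `f, g ∉ E′`, the IET sum over the colourings of `E′ + f + g` splits EXACTLY into three IET sums:
* the slice `f` red, `g` blue: the IET sum of `(ends, E′)` for the event `η ↦ 𝒱(η + f)` with all six levels precomposed with `insert x`;
* the slice `g` red, `f` blue: the IET sum of `(ends, E′)` for `η ↦ 𝒱(η + g)` with `h, k, hᵇ, kᵇ` precomposed with `insert x`;
* the two boundary slices: the IET sum of the graph in which the path is replaced by ONE edge `f` with `ends′ f = s(u, b)` (`ends′ = ends` on `E′`),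
  for the event `𝒱′ ω = 𝒱(ω + g if f ∈ ω)` and `h, k, hᵇ, kᵇ` precomposed with `insert x` (`iet_split_shortThread`).
(The parallel-edge identity (A3) is `iet_split_parallelEdge` in …ShortThreadEdge.)
Consequences (…ShortThreadsMain): CONJECTURE IET on every bundle with at most two threads of length ≥ 3.
[cite: KozmaNitzan2024, Questions 8–9 (§5.5 p. 36) (context); Harris 1960]
-/

namespace Summit.CriticalPhenomena.PercolationContinuityZ3.Theorems

open Finset Literature.Probability.Percolation

namespace Coefficientwise

variable {ι V : Type*}

open Classical in
/-- **THEOREM A for a thread of length 2, as an identity.**  `E′` an edge set of a multigraph `ends`, `f ≠ g ∉ E′` with `ends f = s(u,x)`,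
`ends g = s(x,b)` for a vertex `x ∉` every edge of `E′`, `x ≠ u, b`, `u ≠ b`; `ends′` agrees with `ends` on `E′` and `ends′ f = s(u,b)`.
Then the IET sum of `(ends, E′+f+g)` for `𝒱` and levels `h,k,hᵃ,hᵇ,kᵃ,kᵇ` equals
  IET(ends, E′)[`𝒱(·+f)`; all levels ∘ `insert x`] + IET(ends, E′)[`𝒱(·+g)`; `h,k,hᵇ,kᵇ ∘ insert x`, `hᵃ,kᵃ`]
  + IET(ends′, E′+f)[`ω ↦ 𝒱(ω+g if f∈ω else ω)`; `h,k,hᵇ,kᵇ ∘ insert x`, `hᵃ,kᵃ`].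
[cite: KozmaNitzan2024, Questions 8–9 (§5.5 p. 36) (context)] -/
theorem iet_split_shortThread (ends ends' : ι → Sym2 V) (E' : Finset ι) (f g : ι) (u b x : V)
    (hfg : f ≠ g) (hfE' : f ∉ E') (hgE' : g ∉ E') (hf : ends f = s(u, x)) (hg : ends g = s(x, b))
    (hxu : x ≠ u) (hxb : x ≠ b) (hub : u ≠ b) (hxE' : ∀ i ∈ E', x ∉ ends i)
    (hends' : ∀ i ∈ E', ends' i = ends i) (hf' : ends' f = s(u, b))
    (𝒱 : Finset ι → Prop) (h k ha hb ka kb : Set V → ℝ) :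
    ((∑ ω ∈ (insert f (insert g E')).powerset, if 𝒱 ω ∧ b ∈ openCluster (ends '' (↑ω : Set ι)) u ∧
          b ∉ openCluster (ends '' (↑((insert f (insert g E')) \ ω) : Set ι)) u then
        h (openCluster (ends '' (↑ω : Set ι)) u) * k (openCluster (ends '' (↑ω : Set ι)) u) else 0)
      + ∑ ω ∈ (insert f (insert g E')).powerset, if 𝒱 ω ∧ b ∈ openCluster (ends '' (↑((insert f (insert g E')) \ ω) : Set ι)) u ∧
          b ∉ openCluster (ends '' (↑ω : Set ι)) u then
        (ha (openCluster (ends '' (↑ω : Set ι)) u) - hb (openCluster (ends '' (↑((insert f (insert g E')) \ ω) : Set ι)) u)) *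
          (ka (openCluster (ends '' (↑ω : Set ι)) u) - kb (openCluster (ends '' (↑((insert f (insert g E')) \ ω) : Set ι)) u)) else 0)
    = ((∑ η ∈ E'.powerset, if 𝒱 (insert f η) ∧ b ∈ openCluster (ends '' (↑η : Set ι)) u ∧ b ∉ openCluster (ends '' (↑(E' \ η) : Set ι)) u then
          h (insert x (openCluster (ends '' (↑η : Set ι)) u)) * k (insert x (openCluster (ends '' (↑η : Set ι)) u)) else 0)
        + ∑ η ∈ E'.powerset, if 𝒱 (insert f η) ∧ b ∈ openCluster (ends '' (↑(E' \ η) : Set ι)) u ∧ b ∉ openCluster (ends '' (↑η : Set ι)) u then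
          (ha (insert x (openCluster (ends '' (↑η : Set ι)) u)) - hb (insert x (openCluster (ends '' (↑(E' \ η) : Set ι)) u))) *
            (ka (insert x (openCluster (ends '' (↑η : Set ι)) u)) - kb (insert x (openCluster (ends '' (↑(E' \ η) : Set ι)) u))) else 0)
      + ((∑ η ∈ E'.powerset, if 𝒱 (insert g η) ∧ b ∈ openCluster (ends '' (↑η : Set ι)) u ∧ b ∉ openCluster (ends '' (↑(E' \ η) : Set ι)) u then
          h (insert x (openCluster (ends '' (↑η : Set ι)) u)) * k (insert x (openCluster (ends '' (↑η : Set ι)) u)) else 0)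
        + ∑ η ∈ E'.powerset, if 𝒱 (insert g η) ∧ b ∈ openCluster (ends '' (↑(E' \ η) : Set ι)) u ∧ b ∉ openCluster (ends '' (↑η : Set ι)) u then
          (ha (openCluster (ends '' (↑η : Set ι)) u) - hb (insert x (openCluster (ends '' (↑(E' \ η) : Set ι)) u))) *
            (ka (openCluster (ends '' (↑η : Set ι)) u) - kb (insert x (openCluster (ends '' (↑(E' \ η) : Set ι)) u))) else 0)
      + ((∑ ω ∈ (insert f E').powerset, if 𝒱 (if f ∈ ω then insert g ω else ω) ∧ b ∈ openCluster (ends' '' (↑ω : Set ι)) u ∧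
            b ∉ openCluster (ends' '' (↑((insert f E') \ ω) : Set ι)) u then
          h (insert x (openCluster (ends' '' (↑ω : Set ι)) u)) * k (insert x (openCluster (ends' '' (↑ω : Set ι)) u)) else 0)
        + ∑ ω ∈ (insert f E').powerset, if 𝒱 (if f ∈ ω then insert g ω else ω) ∧ b ∈ openCluster (ends' '' (↑((insert f E') \ ω) : Set ι)) u ∧
            b ∉ openCluster (ends' '' (↑ω : Set ι)) u then
          (ha (openCluster (ends' '' (↑ω : Set ι)) u) - hb (insert x (openCluster (ends' '' (↑((insert f E') \ ω) : Set ι)) u))) *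
            (ka (openCluster (ends' '' (↑ω : Set ι)) u) - kb (insert x (openCluster (ends' '' (↑((insert f E') \ ω) : Set ι)) u))) else 0) := by
  set E : Finset ι := insert f (insert g E') with hE
  set C : Finset ι → Set V := fun ω => openCluster (ends '' (↑ω : Set ι)) u with hC
  set C' : Finset ι → Set V := fun ω => openCluster (ends' '' (↑ω : Set ι)) u with hC'
  have hbx : b ≠ x := fun h => hxb h.symm
  have hfgE' : f ∉ insert g E' := by
    rw [Finset.mem_insert]; rintro (h' | h'); exact hfg h'; exact hfE' h'
  -- ### cluster identities for the four slices (η ⊆ E′)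
  have sdiff_f : ∀ η, η ⊆ E' → E \ insert f η = insert g (E' \ η) :=
    sdiff_insert_insert_f E E' f g hE hfg hfE' hgE'
  have sdiff_g : ∀ η, η ⊆ E' → E \ insert g η = insert f (E' \ η) :=
    sdiff_insert_insert_g E E' f g hE hfg hfE' hgE'
  have sdiff_0 : ∀ η, η ⊆ E' → E \ η = insert f (insert g (E' \ η)) :=
    sdiff_insert_insert_none E E' f g hE hfE' hgE'
  have sdiff_fg : ∀ η : Finset ι, E \ insert f (insert g η) = E' \ η :=
    sdiff_insert_insert_both E E' f g hE hfE' hgE'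
  have hxE'sub : ∀ η, η ⊆ E' → ∀ i ∈ η, x ∉ ends i := fun η hη i hi => hxE' i (hη hi)
  have hxE'sd : ∀ η : Finset ι, ∀ i ∈ E' \ η, x ∉ ends i := fun η i hi => hxE' i (Finset.sdiff_subset hi)
  have Cf : ∀ η, η ⊆ E' → C (insert f η) = insert x (C η) := fun η hη =>
    cluster_insert_hubEdge_u ends η f u x hf (hxE'sub η hη)
  have Cg : ∀ η, η ⊆ E' → C (insert g η) = C η ∪ {y | y = x ∧ b ∈ C η} := fun η hη =>
    cluster_insert_hubEdge_b ends η g u b x hg hxu hxb (hxE'sub η hη)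
  have Cf' : ∀ η : Finset ι, C (insert f (E' \ η)) = insert x (C (E' \ η)) := fun η =>
    cluster_insert_hubEdge_u ends (E' \ η) f u x hf (hxE'sd η)
  have Cg' : ∀ η : Finset ι, C (insert g (E' \ η)) = C (E' \ η) ∪ {y | y = x ∧ b ∈ C (E' \ η)} := fun η =>
    cluster_insert_hubEdge_b ends (E' \ η) g u b x hg hxu hxb (hxE'sd η)
  -- ### the same for the edge picture (ends′, E′ + f)
  have hfdiff : ∀ η, η ⊆ E' → insert f E' \ insert f η = E' \ η := by
    intro η hη
    ext i
    simp only [Finset.mem_sdiff, Finset.mem_insert]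
    constructor
    · rintro ⟨h1, h2⟩
      push Not at h2
      rcases h1 with rfl | h1
      · exact absurd rfl h2.1
      · exact ⟨h1, h2.2⟩
    · rintro ⟨h1, h2⟩
      refine ⟨Or.inr h1, ?_⟩
      push Not; exact ⟨fun h' => hfE' (h' ▸ h1), h2⟩
  have hfdiff0 : ∀ η, η ⊆ E' → insert f E' \ η = insert f (E' \ η) := by
    intro η hη
    ext i
    simp only [Finset.mem_sdiff, Finset.mem_insert]
    constructor
    · rintro ⟨h1, h2⟩
      rcases h1 with rfl | h1
      · exact Or.inl rfl
      · exact Or.inr ⟨h1, h2⟩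
    · rintro (rfl | ⟨h1, h2⟩)
      · exact ⟨Or.inl rfl, fun h' => hfE' (hη h')⟩
      · exact ⟨Or.inr h1, h2⟩
  have C'eq : ∀ η, η ⊆ E' → C' η = C η := by
    intro η hη
    simp only [hC', hC]
    rw [ends_image_coe_congr ends ends' η (fun i hi => hends' i (hη hi))]
  have C'eqd : ∀ η : Finset ι, C' (E' \ η) = C (E' \ η) := fun η => C'eq (E' \ η) Finset.sdiff_subset
  -- pendant path (two edges) versus pendant edge
  have path_edge : ∀ η, η ⊆ E' → C (insert f (insert g η)) = insert x (C' (insert f η)) := by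
    intro η hη
    simp only [hC, hC']
    rw [ends_image_coe_insert, ends_image_coe_insert, hf, hg, ends_image_coe_insert, hf',
      ends_image_coe_congr ends ends' η (fun i hi => hends' i (hη hi))]
    apply cluster_path_two_eq_insert _ u b x hxu hxb hub
    rintro z ⟨i, hi, rfl⟩
    exact hxE' i (hη (Finset.mem_coe.mp hi))
  have path_edge' : ∀ η : Finset ι, C (insert f (insert g (E' \ η))) = insert x (C' (insert f (E' \ η))) :=
    fun η => path_edge (E' \ η) Finset.sdiff_subset
  -- membership bookkeeping
  have mem_union_x : ∀ (S : Set V) (P : Prop), b ∈ S ∪ {y | y = x ∧ P} ↔ b ∈ S := fun S P => mem_union_single_iff hbx S P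
  have union_x_of : ∀ (S : Set V) (P : Prop), P → S ∪ {y | y = x ∧ P} = insert x S := fun S P hP => union_single_of_pos x S P hP
  have union_x_of_not : ∀ (S : Set V) (P : Prop), ¬ P → S ∪ {y | y = x ∧ P} = S := fun S P hP => union_single_of_neg x S P hP
  have mem_insert_x : ∀ (S : Set V), b ∈ insert x S ↔ b ∈ S := fun S => mem_insert_iff_of_ne hbx S
  -- ### the summands of the left-hand side
  set FR : Finset ι → ℝ := fun ω => if 𝒱 ω ∧ b ∈ C ω ∧ b ∉ C (E \ ω) then h (C ω) * k (C ω) else 0 with hFR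
  set FD : Finset ι → ℝ := fun ω => if 𝒱 ω ∧ b ∈ C (E \ ω) ∧ b ∉ C ω then
      (ha (C ω) - hb (C (E \ ω))) * (ka (C ω) - kb (C (E \ ω))) else 0 with hFD
  -- the summands of the edge picture
  set GR : Finset ι → ℝ := fun ω => if 𝒱 (if f ∈ ω then insert g ω else ω) ∧ b ∈ C' ω ∧ b ∉ C' (insert f E' \ ω) then
      h (insert x (C' ω)) * k (insert x (C' ω)) else 0 with hGR
  set GD : Finset ι → ℝ := fun ω => if 𝒱 (if f ∈ ω then insert g ω else ω) ∧ b ∈ C' (insert f E' \ ω) ∧ b ∉ C' ω then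
      (ha (C' ω) - hb (insert x (C' (insert f E' \ ω)))) * (ka (C' ω) - kb (insert x (C' (insert f E' \ ω)))) else 0 with hGD
  change (∑ ω ∈ E.powerset, FR ω) + ∑ ω ∈ E.powerset, FD ω = _ + _ + ((∑ ω ∈ (insert f E').powerset, GR ω) + ∑ ω ∈ (insert f E').powerset, GD ω)
  -- splitting the sums
  have split : ∀ F : Finset ι → ℝ, ∑ ω ∈ E.powerset, F ω =
      (∑ η ∈ E'.powerset, F η) + (∑ η ∈ E'.powerset, F (insert g η)) +
        ((∑ η ∈ E'.powerset, F (insert f η)) + ∑ η ∈ E'.powerset, F (insert f (insert g η))) := by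
    intro F
    rw [hE, Finset.sum_powerset_insert hfgE', Finset.sum_powerset_insert hgE', Finset.sum_powerset_insert hgE']
  have split' : ∀ F : Finset ι → ℝ, ∑ ω ∈ (insert f E').powerset, F ω =
      (∑ η ∈ E'.powerset, F η) + ∑ η ∈ E'.powerset, F (insert f η) := fun F => Finset.sum_powerset_insert hfE' F
  rw [split FR, split FD, split' GR, split' GD]
  -- ### slice f red, g blue
  have eRf : ∀ η ∈ E'.powerset, FR (insert f η) = (if 𝒱 (insert f η) ∧ b ∈ C η ∧ b ∉ C (E' \ η) then
      h (insert x (C η)) * k (insert x (C η)) else 0) := by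
    intro η hη
    rw [Finset.mem_powerset] at hη
    simp only [hFR]
    apply ite_zero_congr
    · rw [sdiff_f η hη, Cf η hη, Cg' η, mem_insert_x, mem_union_x]
    · intro hq
      have hbx' : b ∈ C η := by
        have := hq.2.1; exact this
      rw [Cf η hη]
  have eDf : ∀ η ∈ E'.powerset, FD (insert f η) = (if 𝒱 (insert f η) ∧ b ∈ C (E' \ η) ∧ b ∉ C η then
      (ha (insert x (C η)) - hb (insert x (C (E' \ η)))) * (ka (insert x (C η)) - kb (insert x (C (E' \ η)))) else 0) := by
    intro η hη
    rw [Finset.mem_powerset] at hη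
    simp only [hFD]
    apply ite_zero_congr
    · rw [sdiff_f η hη, Cf η hη, Cg' η, mem_insert_x, mem_union_x]
    · intro hq
      have hbY : b ∈ C (E' \ η) := hq.2.1
      rw [sdiff_f η hη, Cg' η, union_x_of _ _ hbY, Cf η hη]
  -- ### slice g red, f blue
  have eRg : ∀ η ∈ E'.powerset, FR (insert g η) = (if 𝒱 (insert g η) ∧ b ∈ C η ∧ b ∉ C (E' \ η) then
      h (insert x (C η)) * k (insert x (C η)) else 0) := by
    intro η hη
    rw [Finset.mem_powerset] at hη
    simp only [hFR]
    apply ite_zero_congr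
    · rw [sdiff_g η hη, Cg η hη, Cf' η, mem_union_x, mem_insert_x]
    · intro hq
      have hbX : b ∈ C η := hq.2.1
      rw [Cg η hη, union_x_of _ _ hbX]
  have eDg : ∀ η ∈ E'.powerset, FD (insert g η) = (if 𝒱 (insert g η) ∧ b ∈ C (E' \ η) ∧ b ∉ C η then
      (ha (C η) - hb (insert x (C (E' \ η)))) * (ka (C η) - kb (insert x (C (E' \ η)))) else 0) := by
    intro η hη
    rw [Finset.mem_powerset] at hη
    simp only [hFD]
    apply ite_zero_congr
    · rw [sdiff_g η hη, Cg η hη, Cf' η, mem_union_x, mem_insert_x]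
    · intro hq
      have hbn : b ∉ C η := hq.2.2
      rw [Cg η hη, union_x_of_not _ _ hbn, sdiff_g η hη, Cf' η]
  -- ### boundary slices: the edge picture
  have eR0 : ∀ η ∈ E'.powerset, FR η = GR η := by
    intro η hη
    rw [Finset.mem_powerset] at hη
    have hfη : f ∉ η := fun h' => hfE' (hη h')
    simp only [hFR, hGR, if_neg hfη]
    apply ite_zero_congr
    · rw [sdiff_0 η hη, path_edge' η, hfdiff0 η hη, mem_insert_x, C'eq η hη]
    · intro hq
      exfalso
      -- b is joined to u by the blue pendant edge: no supply here on either side (both conditions fail)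
      have : b ∈ C' (insert f E' \ η) := by
        rw [hfdiff0 η hη]
        simp only [hC']
        rw [ends_image_coe_insert, hf']
        exact mem_openCluster_of_mem_pair (Set.mem_insert _ _) (mem_openCluster_self _ _)
      exact hq.2.2 this
  have eD0 : ∀ η ∈ E'.powerset, FD η = GD η := by
    intro η hη
    rw [Finset.mem_powerset] at hη
    have hfη : f ∉ η := fun h' => hfE' (hη h')
    simp only [hFD, hGD, if_neg hfη]
    apply ite_zero_congr
    · rw [sdiff_0 η hη, path_edge' η, hfdiff0 η hη, mem_insert_x, C'eq η hη]
    · intro _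
      rw [sdiff_0 η hη, path_edge' η, hfdiff0 η hη, C'eq η hη]
  have eR2 : ∀ η ∈ E'.powerset, FR (insert f (insert g η)) = GR (insert f η) := by
    intro η hη
    rw [Finset.mem_powerset] at hη
    simp only [hFR, hGR, if_pos (Finset.mem_insert_self f η)]
    apply ite_zero_congr
    · rw [sdiff_fg η, path_edge η hη, hfdiff η hη, mem_insert_x, C'eqd η, Finset.insert_comm]
    · intro _
      rw [path_edge η hη]
  have eD2 : ∀ η ∈ E'.powerset, FD (insert f (insert g η)) = GD (insert f η) := by
    intro η hη
    rw [Finset.mem_powerset] at hη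
    simp only [hFD, hGD, if_pos (Finset.mem_insert_self f η)]
    apply ite_zero_congr
    · rw [sdiff_fg η, path_edge η hη, hfdiff η hη, mem_insert_x, C'eqd η, Finset.insert_comm]
    · intro hq
      exfalso
      -- b is joined to u by the red pendant edge: no demand here on either side
      have : b ∈ C' (insert f η) := by
        simp only [hC']
        rw [ends_image_coe_insert, hf']
        exact mem_openCluster_of_mem_pair (Set.mem_insert _ _) (mem_openCluster_self _ _)
      exact hq.2.2 this
  rw [Finset.sum_congr rfl eRf, Finset.sum_congr rfl eDf, Finset.sum_congr rfl eRg, Finset.sum_congr rfl eDg,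
    Finset.sum_congr rfl eR0, Finset.sum_congr rfl eD0, Finset.sum_congr rfl eR2, Finset.sum_congr rfl eD2]
  ring

end Coefficientwise

end Summit.CriticalPhenomena.PercolationContinuityZ3.Theorems
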